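import Literature.Analysis.FluidPDE.HeatDuhamelSmooth
import Literature.Analysis.FluidPDE.KochTataruKernel
import Literature.Analysis.UnboundedOperators.HeatFlowCalculus
import Mathlib.Analysis.SpecialFunctions.Integrability.Basic
import HarnessLib

/-!
# Backward space–time kernels: the heat kernel and its gradient

Analysis/FluidPDE support file for the discharge of the named fact
`Literature.Analysis.FluidPDE.NSBoundedInteriorContinuity` (`NSBoundedInteriorRegularity.lean`;
Seregin–Šverák 2009, §2). The duality proof represents the solution through space–time
potentials `K ⋆ f` on `ℝ × E` whose kernels are **backward** kernels built from one-parameter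
families `κ a` (`a > 0` the elapsed time): `K(τ, y) = κ(-τ)(y)` for `τ < 0` and `0` for
`τ ≥ 0` — exactly the shape of the accepted `heatDuhamelKernel` of `HeatDuhamelSmooth.lean`
(`𝒰[Θ] = heatDuhamelKernel ν ⋆ uncurry Θ`). This file

* defines `backKernel κ` and proves the transfer lemmas feeding the hypotheses of
  `CaloricPotentialContinuity.lean` (measurability from joint continuity of `κ` on
  `(0, ∞) × E`, continuity off the slice `τ = 0`, bounds on `{ε ≤ |τ|}` and on `ℝ × D`, the
  time-slice bound `∫ |K(τ, y)| dy ≤ N₀(|τ|)`), and the local integrability of the model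
  majorant `C (1 + |τ|^{-1/2})`;
* instantiates them for the Gauss–Weierstrass kernel `G_a` (`heatDuhamelKernel 1 = backKernel G`)
  and for its directional derivatives `∂ᵥG_a` (`heatKernelGrad v a y`), in every finite
  dimension `d`: joint continuity, the bounds `G_a(y) ≤ (4πa)^{-d/2}`,
  `G_a(y) ≤ C δ^{-d}` for `‖y‖ ≥ δ` (uniformly in `a`), `∫ G_a = 1`,
  `|∂ᵥG_a(y)| ≤ C ‖v‖ (a + ‖y‖²)^{-(d+1)/2}` (whence `≤ C‖v‖ a^{-(d+1)/2}`, `≤ C‖v‖δ^{-(d+1)}` off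
  the diagonal, and `∫ |∂ᵥG_a| ≤ 2^{d/2} a^{-1/2} ‖v‖`).

All statements are standard heat-kernel calculus (Evans, *PDE*, §2.3.1; Koch–Tataru 2001, §2,
(8): Gaussian decay against the parabolic distance, here through the tree's
`exists_heatKernel_le_rpow`).
-/

noncomputable section

open MeasureTheory Set Function Filter Metric Real
open scoped ENNReal NNReal Topology RealInnerProductSpace

namespace Literature.Analysis.FluidPDE

variable {E : Type*} [NormedAddCommGroup E] [InnerProductSpace ℝ E] [FiniteDimensional ℝ E]
  [MeasurableSpace E] [BorelSpace E]

/-! ### Backward kernels from one-parameter families -/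

/-- The **backward space–time kernel** of a one-parameter family `κ : ℝ → E → ℝ`
(`κ a` = the kernel after elapsed time `a > 0`): `backKernel κ (τ, y) = κ (-τ) y` for `τ < 0`
and `0` for `τ ≥ 0`. With `κ a = G_{νa}` this is the accepted `heatDuhamelKernel ν`
(`heatDuhamelKernel_one_eq_backKernel`); convolution with it is the backward Duhamel integral
`(backKernel κ ⋆ g)(s, x) = ∫_{t > s} ∫ κ(t - s)(x - y) g(t, y) dy dt` (Evans, *PDE*, §2.3.1 c).
[folklore] -/
def backKernel (κ : ℝ → E → ℝ) (p : ℝ × E) : ℝ :=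
  if p.1 < 0 then κ (-p.1) p.2 else 0

omit [NormedAddCommGroup E] [InnerProductSpace ℝ E] [FiniteDimensional ℝ E] [MeasurableSpace E]
  [BorelSpace E] in
/-- Unfolding the backward kernel at negative times. [folklore] -/
theorem backKernel_of_neg (κ : ℝ → E → ℝ) {τ : ℝ} (hτ : τ < 0) (y : E) :
    backKernel κ (τ, y) = κ (-τ) y := by
  simp [backKernel, hτ]

omit [NormedAddCommGroup E] [InnerProductSpace ℝ E] [FiniteDimensional ℝ E] [MeasurableSpace E]
  [BorelSpace E] in
/-- The backward kernel vanishes at nonnegative times. [folklore] -/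
theorem backKernel_of_nonneg (κ : ℝ → E → ℝ) {τ : ℝ} (hτ : 0 ≤ τ) (y : E) :
    backKernel κ (τ, y) = 0 := by
  simp [backKernel, not_lt.2 hτ]

omit [NormedAddCommGroup E] [InnerProductSpace ℝ E] [FiniteDimensional ℝ E] [MeasurableSpace E]
  [BorelSpace E] in
/-- The backward kernel as a `piecewise` function on the open half-space `{τ < 0}`.
[folklore] -/
theorem backKernel_eq_piecewise (κ : ℝ → E → ℝ) :
    backKernel κ = {p : ℝ × E | p.1 < 0}.piecewise (fun p => κ (-p.1) p.2) 0 := by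
  funext p
  by_cases h : p.1 < 0
  · rw [piecewise_eq_of_mem _ _ _ (show p ∈ {p : ℝ × E | p.1 < 0} from h)]
    simp [backKernel, h]
  · rw [piecewise_eq_of_notMem _ _ _ (show p ∉ {p : ℝ × E | p.1 < 0} from h)]
    simp [backKernel, h]

omit [InnerProductSpace ℝ E] [FiniteDimensional ℝ E] in
/-- **Measurability from joint continuity**: if `(a, y) ↦ κ a y` is continuous on
`(0, ∞) × E`, then `backKernel κ` is measurable (a piecewise function continuous on each
piece). [folklore] -/
theorem measurable_backKernel {κ : ℝ → E → ℝ}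
    (hκ : ContinuousOn (fun q : ℝ × E => κ q.1 q.2) (Ioi 0 ×ˢ univ)) :
    Measurable (backKernel κ) := by
  rw [backKernel_eq_piecewise]
  refine ContinuousOn.measurable_piecewise ?_ continuousOn_const ?_
  · have hmap : ContinuousOn (fun p : ℝ × E => ((-p.1, p.2) : ℝ × E)) {p : ℝ × E | p.1 < 0} :=
      (continuous_fst.neg.prodMk continuous_snd).continuousOn
    refine (hκ.comp hmap fun p hp => ⟨?_, mem_univ _⟩)
    exact mem_Ioi.2 (neg_pos.2 hp)
  · exact measurableSet_lt measurable_fst measurable_const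

omit [InnerProductSpace ℝ E] [FiniteDimensional ℝ E] [MeasurableSpace E] [BorelSpace E] in
/-- **Continuity off the slice `τ = 0`**: if `κ` is jointly continuous on `(0, ∞) × E` then
`backKernel κ` is continuous at every point with `τ ≠ 0` (it is `κ(-τ)(y)` near points with
`τ < 0` and identically `0` near points with `τ > 0`). [folklore] -/
theorem continuousAt_backKernel {κ : ℝ → E → ℝ}
    (hκ : ContinuousOn (fun q : ℝ × E => κ q.1 q.2) (Ioi 0 ×ˢ univ))
    (p : ℝ × E) (hp : p.1 ≠ 0) : ContinuousAt (backKernel κ) p := by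
  rcases lt_or_gt_of_ne hp with h | h
  · have ho : IsOpen {q : ℝ × E | q.1 < 0} := isOpen_lt continuous_fst continuous_const
    have hev : ∀ᶠ q in 𝓝 p, backKernel κ q = κ (-q.1) q.2 := by
      filter_upwards [ho.mem_nhds h] with q hq
      exact backKernel_of_neg κ hq q.2
    refine ContinuousAt.congr ?_ (EventuallyEq.symm hev)
    have h1 : ContinuousAt (fun q : ℝ × E => ((-q.1, q.2) : ℝ × E)) p :=
      (continuous_fst.neg.prodMk continuous_snd).continuousAt
    have h2 : ContinuousAt (fun q : ℝ × E => κ q.1 q.2) (-p.1, p.2) :=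
      hκ.continuousAt ((isOpen_Ioi.prod isOpen_univ).mem_nhds ⟨neg_pos.2 h, mem_univ _⟩)
    exact ContinuousAt.comp_of_eq h2 h1 rfl
  · have ho : IsOpen {q : ℝ × E | 0 < q.1} := isOpen_lt continuous_const continuous_fst
    have hev : ∀ᶠ q in 𝓝 p, backKernel κ q = 0 := by
      filter_upwards [ho.mem_nhds h] with q hq
      exact backKernel_of_nonneg κ hq.le q.2
    exact continuousAt_const.congr (EventuallyEq.symm hev)

omit [NormedAddCommGroup E] [InnerProductSpace ℝ E] [FiniteDimensional ℝ E] [MeasurableSpace E]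
  [BorelSpace E] in
/-- **Bound on `{ε ≤ |τ|}`** from a bound of the family for `a ≥ ε`. [folklore] -/
theorem abs_backKernel_le_of_le_abs {κ : ℝ → E → ℝ} {ε B : ℝ} (hB0 : 0 ≤ B)
    (hB : ∀ a, ε ≤ a → ∀ y, |κ a y| ≤ B) (p : ℝ × E) (hp : ε ≤ |p.1|) :
    |backKernel κ p| ≤ B := by
  by_cases h : p.1 < 0
  · rw [show p = (p.1, p.2) from rfl, backKernel_of_neg κ h]
    exact hB _ (by rwa [abs_of_neg h] at hp) _
  · rw [show p = (p.1, p.2) from rfl, backKernel_of_nonneg κ (not_lt.1 h), abs_zero]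
    exact hB0

omit [NormedAddCommGroup E] [InnerProductSpace ℝ E] [FiniteDimensional ℝ E] [MeasurableSpace E]
  [BorelSpace E] in
/-- **Bound on `ℝ × D`** from a bound of the family on `D` for all `a > 0`. [folklore] -/
theorem abs_backKernel_le_on {κ : ℝ → E → ℝ} {D : Set E} {B : ℝ} (hB0 : 0 ≤ B)
    (hB : ∀ a, 0 < a → ∀ y ∈ D, |κ a y| ≤ B) (τ : ℝ) (y : E) (hy : y ∈ D) :
    |backKernel κ (τ, y)| ≤ B := by
  by_cases h : τ < 0
  · rw [backKernel_of_neg κ h]; exact hB _ (neg_pos.2 h) y hy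
  · rw [backKernel_of_nonneg κ (not_lt.1 h), abs_zero]; exact hB0

omit [InnerProductSpace ℝ E] [FiniteDimensional ℝ E] [MeasurableSpace E] [BorelSpace E] in
/-- Continuity on `ℝ × D` off the slice `τ = 0` (the off-diagonal hypothesis of
`continuousOn_convolution_of_offDiag`) from joint continuity of the family. [folklore] -/
theorem continuousAt_backKernel_on {κ : ℝ → E → ℝ}
    (hκ : ContinuousOn (fun q : ℝ × E => κ q.1 q.2) (Ioi 0 ×ˢ univ)) (D : Set E) :
    ∀ τ : ℝ, τ ≠ 0 → ∀ y ∈ D, ContinuousAt (backKernel κ) (τ, y) :=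
  fun τ hτ y _ => continuousAt_backKernel hκ (τ, y) hτ

/-- **Time-slice bound**: if `∫ |κ a y| dy ≤ N₀(a)` for `a > 0`, then
`∫ |backKernel κ (τ, y)| dy ≤ N₀(|τ|)` for every `τ` (the slices at `τ ≥ 0` vanish).
[folklore] -/
theorem lintegral_enorm_backKernel_le {κ : ℝ → E → ℝ} {N₀ : ℝ → ℝ}
    (hN : ∀ a, 0 < a → ∫⁻ y, ‖κ a y‖ₑ ≤ ENNReal.ofReal (N₀ a)) (τ : ℝ) :
    ∫⁻ y, ‖backKernel κ (τ, y)‖ₑ ≤ ENNReal.ofReal (N₀ |τ|) := by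
  by_cases h : τ < 0
  · simp_rw [backKernel_of_neg κ h]
    rw [abs_of_neg h]
    exact hN _ (neg_pos.2 h)
  · simp_rw [backKernel_of_nonneg κ (not_lt.1 h)]
    simp

/-! ### The model majorant `C (1 + |τ|^{-1/2})` is locally integrable -/

/-- `τ ↦ |τ| ^ r` is integrable on every `[-R, R]` for `-1 < r`. [folklore] -/
theorem integrableOn_abs_rpow_Icc {r : ℝ} (hr : -1 < r) (R : ℝ) :
    IntegrableOn (fun τ : ℝ => |τ| ^ r) (Icc (-R) R) volume := by
  -- on `[0, R]` the function is `τ ^ r`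
  have hpos : ∀ c : ℝ, IntegrableOn (fun τ : ℝ => |τ| ^ r) (Icc 0 c) volume := by
    intro c
    have h := (intervalIntegral.intervalIntegrable_rpow' hr (a := 0) (b := c))
    rcases le_or_gt 0 c with hc | hc
    · rw [intervalIntegrable_iff_integrableOn_Icc_of_le hc] at h
      refine h.congr_fun (fun τ hτ => ?_) measurableSet_Icc
      rw [abs_of_nonneg hτ.1]
    · rw [Icc_eq_empty (not_le.2 hc)]; exact integrableOn_empty
  -- on `[-R, 0]` by the reflection `τ ↦ -τ`
  have hneg : IntegrableOn (fun τ : ℝ => |τ| ^ r) (Icc (-R) 0) volume := by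
    have hmp : MeasurePreserving (fun τ : ℝ => -τ) volume volume :=
      Measure.measurePreserving_neg volume
    have h := hpos R
    have hpre : (fun τ : ℝ => -τ) ⁻¹' Icc 0 R = Icc (-R) 0 := by
      ext τ; simp only [mem_preimage, mem_Icc]; constructor <;> rintro ⟨h1, h2⟩ <;>
        constructor <;> linarith
    have h2 := (hmp.integrableOn_comp_preimage (Homeomorph.neg ℝ).measurableEmbedding).2 h
    rw [hpre] at h2
    refine h2.congr_fun (fun τ _ => ?_) measurableSet_Icc
    simp [abs_neg]
  have hsplit : Icc (-R) R ⊆ Icc (-R) 0 ∪ Icc 0 R := fun τ hτ => by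
    rcases le_or_gt τ 0 with h | h
    · exact Or.inl ⟨hτ.1, h⟩
    · exact Or.inr ⟨h.le, hτ.2⟩
  exact (hneg.union (hpos R)).mono_set hsplit

/-- **The model majorant is locally integrable**: `τ ↦ C (1 + |τ|^{-1/2})` is locally
integrable on `ℝ` (the singularity `|τ|^{-1/2}` is integrable). [folklore] -/
theorem locallyIntegrable_const_mul_one_add_abs_rpow (C : ℝ) :
    LocallyIntegrable (fun τ : ℝ => C * (1 + |τ| ^ (-(1 / 2 : ℝ)))) volume := by
  rw [locallyIntegrable_iff]
  intro K hK
  obtain ⟨R, hR⟩ := (hK.isBounded).subset_closedBall 0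
  have hKI : K ⊆ Icc (-R) R := fun τ hτ => by
    have := hR hτ
    rw [mem_closedBall, dist_zero_right, Real.norm_eq_abs, abs_le] at this
    exact this
  refine IntegrableOn.mono_set ?_ hKI
  have h1 : IntegrableOn (fun _ : ℝ => (1 : ℝ)) (Icc (-R) R) volume := by
    refine integrableOn_const ?_
    rw [Real.volume_Icc]; exact ENNReal.ofReal_ne_top
  have h2 : IntegrableOn (fun τ : ℝ => |τ| ^ (-(1 / 2 : ℝ))) (Icc (-R) R) volume :=
    integrableOn_abs_rpow_Icc (by norm_num) R
  have h3 := (h1.add h2).const_mul C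
  exact h3

/-- The model majorant is nonnegative. [folklore] -/
theorem const_mul_one_add_abs_rpow_nonneg {C : ℝ} (hC : 0 ≤ C) (τ : ℝ) :
    0 ≤ C * (1 + |τ| ^ (-(1 / 2 : ℝ))) := by
  have : 0 ≤ |τ| ^ (-(1 / 2 : ℝ)) := Real.rpow_nonneg (abs_nonneg τ) _
  positivity

/-! ### The heat kernel as a backward kernel -/

omit [FiniteDimensional ℝ E] [MeasurableSpace E] [BorelSpace E] in
/-- `heatDuhamelKernel 1` is the backward kernel of the Gauss–Weierstrass family `a ↦ G_a`.
[folklore] -/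
theorem heatDuhamelKernel_one_eq_backKernel :
    heatDuhamelKernel (E := E) 1 = backKernel (UnboundedOperators.heatKernel (E := E)) := by
  funext p
  by_cases h : p.1 < 0
  · rw [show p = (p.1, p.2) from rfl, heatDuhamelKernel_of_neg h, backKernel_of_neg _ h, one_mul]
  · rw [show p = (p.1, p.2) from rfl, heatDuhamelKernel_of_nonneg (not_lt.1 h),
      backKernel_of_nonneg _ (not_lt.1 h)]

omit [FiniteDimensional ℝ E] [MeasurableSpace E] [BorelSpace E] in
/-- The Gauss–Weierstrass family is jointly continuous on `(0, ∞) × E`. [folklore] -/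
theorem continuousOn_heatKernel_family :
    ContinuousOn (fun q : ℝ × E => UnboundedOperators.heatKernel q.1 q.2) (Ioi 0 ×ˢ univ) :=
  UnboundedOperators.continuousOn_uncurry_heatKernel'

omit [FiniteDimensional ℝ E] [MeasurableSpace E] [BorelSpace E] in
/-- `0 ≤ G_a(y) ≤ (4πa)^{-d/2} ≤ (4πε)^{-d/2}` for `a ≥ ε > 0`. [folklore] -/
theorem abs_heatKernel_le_of_le {ε a : ℝ} (hε : 0 < ε) (ha : ε ≤ a) (y : E) :
    |UnboundedOperators.heatKernel a y| ≤ (4 * π * ε) ^ (-(Module.finrank ℝ E : ℝ) / 2) := by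
  have ha0 : 0 < a := hε.trans_le ha
  rw [abs_of_nonneg (UnboundedOperators.heatKernel_pos ha0 y).le]
  refine (UnboundedOperators.heatKernel_le ha0 y).trans ?_
  exact Real.rpow_le_rpow_of_nonpos (by positivity) (by nlinarith [Real.pi_pos])
    (by rw [neg_div]; exact neg_nonpos.2 (by positivity))

/-- `∫ |G_a| = 1 ≤ 1`: the slice bound of the heat family with `N₀ = 1`. [folklore] -/
theorem lintegral_enorm_heatKernel_le_one {a : ℝ} (ha : 0 < a) :
    ∫⁻ y, ‖UnboundedOperators.heatKernel (E := E) a y‖ₑ ≤ ENNReal.ofReal 1 := by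
  rw [UnboundedOperators.lintegral_enorm_heatKernel ha, ENNReal.ofReal_one]

omit [FiniteDimensional ℝ E] [MeasurableSpace E] [BorelSpace E] in
/-- **Off-diagonal bound for the heat kernel**: there is `C = C(E)` with
`G_a(y) ≤ C δ^{-d}` whenever `a > 0` and `‖y‖ ≥ δ > 0` (Gaussian decay against the parabolic
distance, `G_a(y) ≤ C (a + ‖y‖²)^{-d/2}`; Koch–Tataru 2001, §2 (8)). [folklore] -/
theorem exists_heatKernel_le_of_le_norm :
    ∃ C : ℝ, 0 < C ∧ ∀ {a : ℝ}, 0 < a → ∀ {δ : ℝ}, 0 < δ → ∀ y : E, δ ≤ ‖y‖ →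
      |UnboundedOperators.heatKernel a y| ≤ C * δ ^ (-(Module.finrank ℝ E : ℝ)) := by
  obtain ⟨C, hC, h⟩ := exists_heatKernel_le_rpow (E := E) ((Module.finrank ℝ E : ℝ) / 2)
  refine ⟨C, hC, fun {a} ha {δ} hδ y hy => ?_⟩
  rw [abs_of_nonneg (UnboundedOperators.heatKernel_pos ha y).le]
  have h1 := h ha y
  rw [sub_self, Real.rpow_zero, mul_one] at h1
  refine h1.trans ?_
  gcongr
  -- `(a + ‖y‖²)^{-d/2} ≤ (δ²)^{-d/2} = δ^{-d}`
  have hd : 0 ≤ (Module.finrank ℝ E : ℝ) / 2 := by positivity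
  calc (a + ‖y‖ ^ 2) ^ (-((Module.finrank ℝ E : ℝ) / 2))
      ≤ (δ ^ 2) ^ (-((Module.finrank ℝ E : ℝ) / 2)) := by
        refine Real.rpow_le_rpow_of_nonpos (by positivity) ?_ (neg_nonpos.2 hd)
        nlinarith [pow_le_pow_left₀ hδ.le hy 2]
    _ = δ ^ (-(Module.finrank ℝ E : ℝ)) := by
        rw [← Real.rpow_natCast, ← Real.rpow_mul hδ.le]
        congr 1; push_cast; ring

/-! ### The heat kernel gradient as a backward kernel -/

/-- The **directional derivative family of the heat kernel**, `heatKernelGrad v a y = ∂ᵥG_a(y)`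
(`= -(G_a(y)/(2a)) ⟪y, v⟫`, `UnboundedOperators.fderiv_heatKernel_apply_eq_mul_inner`); its
backward kernel represents `∂ᵥ` of backward Duhamel integrals. [folklore] -/
def heatKernelGrad (v : E) (a : ℝ) (y : E) : ℝ :=
  fderiv ℝ (UnboundedOperators.heatKernel a) y v

omit [FiniteDimensional ℝ E] [MeasurableSpace E] [BorelSpace E] in
/-- Closed form of the gradient family. [folklore] -/
theorem heatKernelGrad_eq (v : E) (a : ℝ) (y : E) :
    heatKernelGrad v a y = -(UnboundedOperators.heatKernel a y / (2 * a)) * ⟪y, v⟫ :=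
  UnboundedOperators.fderiv_heatKernel_apply_eq_mul_inner a y v

omit [FiniteDimensional ℝ E] [MeasurableSpace E] [BorelSpace E] in
/-- The gradient family is jointly continuous on `(0, ∞) × E`. [folklore] -/
theorem continuousOn_heatKernelGrad_family (v : E) :
    ContinuousOn (fun q : ℝ × E => heatKernelGrad v q.1 q.2) (Ioi 0 ×ˢ univ) := by
  have heq : (fun q : ℝ × E => heatKernelGrad v q.1 q.2) =
      fun q : ℝ × E => -(UnboundedOperators.heatKernel q.1 q.2 / (2 * q.1)) * ⟪q.2, v⟫ := by
    funext q; exact heatKernelGrad_eq v q.1 q.2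
  rw [heq]
  refine ((continuousOn_heatKernel_family.div (continuousOn_const.mul continuousOn_fst)
    fun q hq => ?_).neg).mul (continuousOn_snd.inner continuousOn_const)
  have : (0 : ℝ) < q.1 := hq.1
  exact mul_ne_zero two_ne_zero this.ne'

omit [FiniteDimensional ℝ E] [MeasurableSpace E] [BorelSpace E] in
/-- **Pointwise bound for the heat kernel gradient against the parabolic distance**: there is
`C = C(E)` with `|∂ᵥG_a(y)| ≤ C ‖v‖ (a + ‖y‖²)^{-(d+1)/2}` for `a > 0` (from
`G_a ≤ C a (a + ‖y‖²)^{-d/2-1}` and `‖y‖ ≤ (a + ‖y‖²)^{1/2}`; Koch–Tataru 2001, §2 (8)).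
[folklore] -/
theorem exists_abs_heatKernelGrad_le :
    ∃ C : ℝ, 0 < C ∧ ∀ {a : ℝ}, 0 < a → ∀ v y : E,
      |heatKernelGrad v a y| ≤ C * ‖v‖ * (a + ‖y‖ ^ 2) ^ (-(((Module.finrank ℝ E : ℝ) + 1) / 2)) := by
  set d : ℝ := (Module.finrank ℝ E : ℝ) with hd
  obtain ⟨C, hC, h⟩ := exists_heatKernel_le_rpow (E := E) (d / 2 + 1)
  refine ⟨C / 2, by positivity, fun {a} ha v y => ?_⟩
  have hay : 0 < a + ‖y‖ ^ 2 := by positivity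
  have hG := h ha y
  rw [show d / 2 + 1 - (Module.finrank ℝ E : ℝ) / 2 = 1 by rw [hd]; ring, Real.rpow_one] at hG
  rw [heatKernelGrad_eq, abs_mul, abs_neg, abs_div, abs_of_nonneg (UnboundedOperators.heatKernel_pos ha y).le,
    abs_of_pos (by positivity : (0 : ℝ) < 2 * a)]
  -- `|⟪y, v⟫| ≤ ‖y‖ ‖v‖` and `‖y‖ ≤ (a + ‖y‖²)^{1/2}`
  have hin : |⟪y, v⟫| ≤ ‖y‖ * ‖v‖ := abs_real_inner_le_norm y v
  have hy : ‖y‖ ≤ (a + ‖y‖ ^ 2) ^ (1 / 2 : ℝ) := by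
    rw [← Real.sqrt_eq_rpow]
    refine Real.le_sqrt_of_sq_le ?_
    linarith
  calc UnboundedOperators.heatKernel a y / (2 * a) * |⟪y, v⟫|
      ≤ C * a * (a + ‖y‖ ^ 2) ^ (-(d / 2 + 1)) / (2 * a) * (‖y‖ * ‖v‖) := by
        gcongr
    _ = C / 2 * ‖v‖ * ((a + ‖y‖ ^ 2) ^ (-(d / 2 + 1)) * ‖y‖) := by
        field_simp
    _ ≤ C / 2 * ‖v‖ * ((a + ‖y‖ ^ 2) ^ (-(d / 2 + 1)) * (a + ‖y‖ ^ 2) ^ (1 / 2 : ℝ)) := by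
        gcongr
    _ = C / 2 * ‖v‖ * (a + ‖y‖ ^ 2) ^ (-((d + 1) / 2)) := by
        rw [← Real.rpow_add hay]
        congr 2; ring

omit [FiniteDimensional ℝ E] [MeasurableSpace E] [BorelSpace E] in
/-- **Bound on `a ≥ ε`**: `|∂ᵥG_a(y)| ≤ C ‖v‖ ε^{-(d+1)/2}`. [folklore] -/
theorem exists_abs_heatKernelGrad_le_of_le :
    ∃ C : ℝ, 0 < C ∧ ∀ {ε : ℝ}, 0 < ε → ∀ {a : ℝ}, ε ≤ a → ∀ v y : E,
      |heatKernelGrad v a y| ≤ C * ‖v‖ * ε ^ (-(((Module.finrank ℝ E : ℝ) + 1) / 2)) := by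
  obtain ⟨C, hC, h⟩ := exists_abs_heatKernelGrad_le (E := E)
  refine ⟨C, hC, fun {ε} hε {a} ha v y => (h (hε.trans_le ha) v y).trans ?_⟩
  have hd : 0 ≤ ((Module.finrank ℝ E : ℝ) + 1) / 2 := by positivity
  refine mul_le_mul_of_nonneg_left ?_ (by positivity)
  exact Real.rpow_le_rpow_of_nonpos hε (by nlinarith [norm_nonneg y]) (neg_nonpos.2 hd)

omit [FiniteDimensional ℝ E] [MeasurableSpace E] [BorelSpace E] in
/-- **Off-diagonal bound**: `|∂ᵥG_a(y)| ≤ C ‖v‖ δ^{-(d+1)}` for `a > 0`, `‖y‖ ≥ δ > 0`.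
[folklore] -/
theorem exists_abs_heatKernelGrad_le_of_le_norm :
    ∃ C : ℝ, 0 < C ∧ ∀ {a : ℝ}, 0 < a → ∀ {δ : ℝ}, 0 < δ → ∀ v y : E, δ ≤ ‖y‖ →
      |heatKernelGrad v a y| ≤ C * ‖v‖ * δ ^ (-((Module.finrank ℝ E : ℝ) + 1)) := by
  obtain ⟨C, hC, h⟩ := exists_abs_heatKernelGrad_le (E := E)
  refine ⟨C, hC, fun {a} ha {δ} hδ v y hy => (h ha v y).trans ?_⟩
  have hd : 0 ≤ ((Module.finrank ℝ E : ℝ) + 1) / 2 := by positivity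
  refine mul_le_mul_of_nonneg_left ?_ (by positivity)
  calc (a + ‖y‖ ^ 2) ^ (-(((Module.finrank ℝ E : ℝ) + 1) / 2))
      ≤ (δ ^ 2) ^ (-(((Module.finrank ℝ E : ℝ) + 1) / 2)) := by
        refine Real.rpow_le_rpow_of_nonpos (by positivity) ?_ (neg_nonpos.2 hd)
        nlinarith [pow_le_pow_left₀ hδ.le hy 2]
    _ = δ ^ (-((Module.finrank ℝ E : ℝ) + 1)) := by
        rw [← Real.rpow_natCast, ← Real.rpow_mul hδ.le]
        congr 1; push_cast; ring

/-- **Slice bound**: `∫ |∂ᵥG_a| ≤ 2^{d/2} ‖v‖ a^{-1/2}` for `a > 0` (the tree's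
`UnboundedOperators.lintegral_enorm_fderiv_heatKernel_apply_le`). [folklore] -/
theorem lintegral_enorm_heatKernelGrad_le {a : ℝ} (ha : 0 < a) (v : E) :
    ∫⁻ y, ‖heatKernelGrad v a y‖ₑ ≤
      ENNReal.ofReal ((2 : ℝ) ^ ((Module.finrank ℝ E : ℝ) / 2) * ‖v‖ * a ^ (-(1 / 2 : ℝ))) := by
  have h := UnboundedOperators.lintegral_enorm_fderiv_heatKernel_apply_le (E := E) ha v
  refine h.trans (le_of_eq ?_)
  congr 1; ring

/-- The slice bound of the gradient family dominated by the model majorant: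
`∫ |∂ᵥG_a| ≤ 2^{d/2} ‖v‖ (1 + a^{-1/2})`. [folklore] -/
theorem lintegral_enorm_heatKernelGrad_le_model {a : ℝ} (ha : 0 < a) (v : E) :
    ∫⁻ y, ‖heatKernelGrad v a y‖ₑ ≤
      ENNReal.ofReal ((2 : ℝ) ^ ((Module.finrank ℝ E : ℝ) / 2) * ‖v‖ * (1 + |a| ^ (-(1 / 2 : ℝ)))) := by
  refine (lintegral_enorm_heatKernelGrad_le ha v).trans (ENNReal.ofReal_le_ofReal ?_)
  rw [abs_of_pos ha]
  have h0 : 0 ≤ a ^ (-(1 / 2 : ℝ)) := Real.rpow_nonneg ha.le _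
  have h1 : 0 ≤ (2 : ℝ) ^ ((Module.finrank ℝ E : ℝ) / 2) * ‖v‖ := by positivity
  nlinarith

/-! ### The assembled hypotheses for the two backward kernels -/

/-- **The backward heat kernel satisfies the hypotheses of `continuous_convolution_of_sliceBound`**
(measurable; slices bounded by `1`; bounded by `(4πε)^{-d/2}` on `{ε ≤ |τ|}`; continuous off
`τ = 0`). [folklore] -/
theorem backKernel_heatKernel_props :
    Measurable (backKernel (UnboundedOperators.heatKernel (E := E))) ∧
    (∀ τ : ℝ, ∫⁻ y, ‖backKernel (UnboundedOperators.heatKernel (E := E)) (τ, y)‖ₑ ≤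
      ENNReal.ofReal ((fun _ : ℝ => (1 : ℝ)) |τ|)) ∧
    (∀ ε : ℝ, 0 < ε → ∃ B : ℝ, ∀ p : ℝ × E, ε ≤ |p.1| →
      |backKernel (UnboundedOperators.heatKernel (E := E)) p| ≤ B) ∧
    (∀ p : ℝ × E, p.1 ≠ 0 → ContinuousAt (backKernel (UnboundedOperators.heatKernel (E := E))) p) := by
  refine ⟨measurable_backKernel continuousOn_heatKernel_family,
    lintegral_enorm_backKernel_le (fun a ha => lintegral_enorm_heatKernel_le_one ha),
    fun ε hε => ⟨(4 * π * ε) ^ (-(Module.finrank ℝ E : ℝ) / 2), fun p hp =>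
      abs_backKernel_le_of_le_abs (by positivity) (fun a ha y => abs_heatKernel_le_of_le hε ha y) p hp⟩,
    continuousAt_backKernel continuousOn_heatKernel_family⟩

/-- **The backward heat-gradient kernel satisfies the hypotheses of
`continuous_convolution_of_sliceBound`** with the model majorant
`N(τ) = 2^{d/2}‖v‖ (1 + |τ|^{-1/2})`. [folklore] -/
theorem backKernel_heatKernelGrad_props (v : E) :
    Measurable (backKernel (heatKernelGrad v)) ∧
    (∀ τ : ℝ, ∫⁻ y, ‖backKernel (heatKernelGrad v) (τ, y)‖ₑ ≤
      ENNReal.ofReal ((2 : ℝ) ^ ((Module.finrank ℝ E : ℝ) / 2) * ‖v‖ * (1 + |τ| ^ (-(1 / 2 : ℝ))))) ∧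
    (∀ ε : ℝ, 0 < ε → ∃ B : ℝ, ∀ p : ℝ × E, ε ≤ |p.1| → |backKernel (heatKernelGrad v) p| ≤ B) ∧
    (∀ p : ℝ × E, p.1 ≠ 0 → ContinuousAt (backKernel (heatKernelGrad v)) p) := by
  obtain ⟨C, hC, hCb⟩ := exists_abs_heatKernelGrad_le_of_le (E := E)
  refine ⟨measurable_backKernel (continuousOn_heatKernelGrad_family v), fun τ => ?_,
    fun ε hε => ⟨C * ‖v‖ * ε ^ (-(((Module.finrank ℝ E : ℝ) + 1) / 2)), fun p hp =>
      abs_backKernel_le_of_le_abs (by positivity) (fun a ha y => hCb hε ha v y) p hp⟩,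
    continuousAt_backKernel (continuousOn_heatKernelGrad_family v)⟩
  have h := lintegral_enorm_backKernel_le (κ := heatKernelGrad v)
    (N₀ := fun a => (2 : ℝ) ^ ((Module.finrank ℝ E : ℝ) / 2) * ‖v‖ * (1 + |a| ^ (-(1 / 2 : ℝ))))
    (fun a ha => lintegral_enorm_heatKernelGrad_le_model ha v) τ
  simpa only [abs_abs] using h

end Literature.Analysis.FluidPDE
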